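import Literature.Analysis.FunctionSpaces.TorusFourierModes
import HarnessLib

/-!
# Fourier–Galerkin for the Euler equations on `T^d`, I: Sobolev weights and derivative bounds
for real trigonometric polynomials

Analysis/FluidPDE support file (everything proved; no definitions). First file of the
discharge of the named fact `Torus.eulerSmoothShortTime` (`EulerTorusLocalExistence.lean`:
short-time smooth solutions of the Euler equations on `T³` for smooth data, Majda–Bertozzi 2002,
Thm. 3.4, by the energy method) through the Fourier–Galerkin scheme of the tree
(`NSGalerkinFourier.lean` with `ν = 0`): the `H^m` energy estimates of the scheme are carried by
the *pure* iterated partial derivatives `∂ᵢʲ u = (partialDeriv i)^[j] u` of the Galerkin fields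
`u = realTrigPoly S c` (Robinson–Rodrigo–Sadowski 2016, §4.1; Majda–Bertozzi 2002, §3.2.1,
Prop. 3.7 "The `H^m` energy estimate"), and this file records their Fourier description and size:

* `iterate_partialDeriv_realTrigPoly`: `∂ᵢʲ (realTrigPoly S c) = realTrigPoly S ((2πi kᵢ)ʲ • c)`,
  with conjugate symmetry of the symbol family (`IsConjSymm.iterate_deriv`);
* `integral_norm_sq_iterate_partialDeriv_realTrigPoly_le`: the Parseval bound
  `∫ ‖∂ᵢʲu‖² ≤ (2π)^{2j} ∑_{k∈S} (1+|k|²)ʲ ‖c k‖²`;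
* `norm_iterate_partialDeriv_realTrigPoly_le`: the sup bound
  `‖∂ᵢʲu(x)‖ ≤ (2π)ʲ B^{1/2} (∑_{k∈S} (1+|k|²)^{j+2} ‖c k‖²)^{1/2}` whenever
  `∑_{k∈S} (1+|k|²)^{-2} ≤ B` (Cauchy–Schwarz; in dimension `≤ 3` the sum over all of `ℤ^d` is
  finite, which is the embedding `H² ⊂ L^∞`).

The weighted sums `∑_{k∈S} (1+|k|²)ᵐ ‖c k‖²` are written out (no new definition).

## References

* A. J. Majda, A. L. Bertozzi, *Vorticity and Incompressible Flow*, CUP 2002, §3.2.1–3.2.2,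
  Prop. 3.7, Thm. 3.4. [`MajdaBertozziCUP2002`]
* J. C. Robinson, J. L. Rodrigo, W. Sadowski, *The three-dimensional Navier–Stokes equations*,
  CUP 2016, §4.1 (the Galerkin scheme), §1.5 (Sobolev norms by Fourier series).
  [`RobinsonRodrigoSadowski2016`]
-/

noncomputable section

open MeasureTheory Set Filter Function UnitAddTorus
open scoped ENNReal NNReal InnerProductSpace ContDiff

namespace Literature.Analysis.FluidPDE

namespace EulerGalerkin

open FunctionSpaces FunctionSpaces.Torus

variable {d : Type*} [Fintype d] [DecidableEq d]

/-! ## Iterated partial derivatives of real trigonometric polynomials -/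

/-- **`∂ᵢʲ (realTrigPoly S c) = realTrigPoly S ((2πi kᵢ)ʲ • c)`** (iterate
`Torus.partialDeriv_realTrigPoly'`). [folklore] -/
theorem iterate_partialDeriv_realTrigPoly (S : Finset (d → ℤ)) (c : (d → ℤ) → EuclideanSpace ℂ d)
    (i : d) (j : ℕ) :
    (partialDeriv i)^[j] (realTrigPoly S c) =
      realTrigPoly S (fun k => (2 * Real.pi * Complex.I * (k i : ℂ)) ^ j • c k) := by
  induction j with
  | zero => simp
  | succ j IH =>
    rw [iterate_succ_apply', IH, partialDeriv_realTrigPoly']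
    congr 1
    funext k
    rw [smul_smul, ← pow_succ']

omit [Fintype d] [DecidableEq d] in
/-- The iterated derivative symbol preserves conjugate symmetry. [folklore] -/
theorem _root_.Literature.Analysis.FunctionSpaces.Torus.IsConjSymm.iterate_deriv
    {c : (d → ℤ) → EuclideanSpace ℂ d} (hc : IsConjSymm c) (i : d) (j : ℕ) :
    IsConjSymm (fun k : d → ℤ => (2 * Real.pi * Complex.I * (k i : ℂ)) ^ j • c k) := by
  induction j with
  | zero => simpa using hc
  | succ j IH =>
    have h := IH.deriv i
    have heq : (fun k : d → ℤ => (2 * Real.pi * Complex.I * (k i : ℂ)) •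
        ((2 * Real.pi * Complex.I * (k i : ℂ)) ^ j • c k)) =
        fun k : d → ℤ => (2 * Real.pi * Complex.I * (k i : ℂ)) ^ (j + 1) • c k := by
      funext k
      rw [smul_smul, ← pow_succ']
    rwa [heq] at h

omit [DecidableEq d] in
/-- The size of the iterated derivative symbol: `‖(2πi kᵢ)ʲ • z‖ = (2π|kᵢ|)ʲ ‖z‖`. [folklore] -/
theorem norm_derivSymbol_pow_smul (k : d → ℤ) (i : d) (j : ℕ) (z : EuclideanSpace ℂ d) :
    ‖(2 * Real.pi * Complex.I * (k i : ℂ)) ^ j • z‖ = (2 * Real.pi * |(k i : ℝ)|) ^ j * ‖z‖ := by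
  rw [norm_smul, norm_pow, norm_mul, norm_mul, norm_mul, Complex.norm_two, Complex.norm_real,
    Complex.norm_I, mul_one, Real.norm_eq_abs, abs_of_pos Real.pi_pos, Complex.norm_intCast]

omit [DecidableEq d] in
/-- `kᵢ² ≤ |k|²`, hence `(2π|kᵢ|)^{2j} ≤ (2π)^{2j} (1 + |k|²)ʲ`. [folklore] -/
theorem derivSymbol_sq_pow_le (k : d → ℤ) (i : d) (j : ℕ) :
    ((2 * Real.pi * |(k i : ℝ)|) ^ j) ^ 2 ≤ (2 * Real.pi) ^ (2 * j) * (1 + freqNormSq k) ^ j := by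
  have h1 : ((k i : ℝ)) ^ 2 ≤ freqNormSq k :=
    Finset.single_le_sum (f := fun l => ((k l : ℝ)) ^ 2) (fun l _ => sq_nonneg _) (Finset.mem_univ i)
  have h2 : |(k i : ℝ)| ^ 2 ≤ 1 + freqNormSq k := by rw [sq_abs]; linarith
  calc ((2 * Real.pi * |(k i : ℝ)|) ^ j) ^ 2 = (2 * Real.pi) ^ (2 * j) * (|(k i : ℝ)| ^ 2) ^ j := by
        rw [mul_pow, mul_pow, ← pow_mul, ← pow_mul, ← pow_mul, mul_comm j 2, pow_mul |(k i : ℝ)| 2 j]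
    _ ≤ (2 * Real.pi) ^ (2 * j) * (1 + freqNormSq k) ^ j := by
        gcongr

/-! ## `L²` bounds -/

/-- **Parseval bound for pure derivatives**: for conjugate-symmetric `c` on a symmetric `S`,
`∫ ‖∂ᵢʲ (realTrigPoly S c)‖² ≤ (2π)^{2j} ∑_{k∈S} (1+|k|²)ʲ ‖c k‖²`.
[cite: RobinsonRodrigoSadowski2016, §1.5] -/
theorem integral_norm_sq_iterate_partialDeriv_realTrigPoly_le {S : Finset (d → ℤ)}
    (hS : ∀ k ∈ S, -k ∈ S) {c : (d → ℤ) → EuclideanSpace ℂ d} (hc : IsConjSymm c) (i : d) (j : ℕ) :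
    ∫ x, ‖(partialDeriv i)^[j] (realTrigPoly S c) x‖ ^ 2 ≤
      (2 * Real.pi) ^ (2 * j) * ∑ k ∈ S, (1 + freqNormSq k) ^ j * ‖c k‖ ^ 2 := by
  rw [iterate_partialDeriv_realTrigPoly, integral_norm_sq_realTrigPoly hS (hc.iterate_deriv i j),
    Finset.mul_sum]
  refine Finset.sum_le_sum fun k _ => ?_
  rw [norm_derivSymbol_pow_smul, mul_pow]
  calc ((2 * Real.pi * |(k i : ℝ)|) ^ j) ^ 2 * ‖c k‖ ^ 2
      ≤ ((2 * Real.pi) ^ (2 * j) * (1 + freqNormSq k) ^ j) * ‖c k‖ ^ 2 :=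
        mul_le_mul_of_nonneg_right (derivSymbol_sq_pow_le k i j) (sq_nonneg _)
    _ = (2 * Real.pi) ^ (2 * j) * ((1 + freqNormSq k) ^ j * ‖c k‖ ^ 2) := by ring

/-- The exact Parseval identity for pure derivatives:
`∫ ‖∂ᵢʲ (realTrigPoly S c)‖² = ∑_{k∈S} (2π|kᵢ|)^{2j} ‖c k‖²`. [cite: RobinsonRodrigoSadowski2016, §1.5] -/
theorem integral_norm_sq_iterate_partialDeriv_realTrigPoly {S : Finset (d → ℤ)}
    (hS : ∀ k ∈ S, -k ∈ S) {c : (d → ℤ) → EuclideanSpace ℂ d} (hc : IsConjSymm c) (i : d) (j : ℕ) :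
    ∫ x, ‖(partialDeriv i)^[j] (realTrigPoly S c) x‖ ^ 2 =
      ∑ k ∈ S, ((2 * Real.pi * |(k i : ℝ)|) ^ j) ^ 2 * ‖c k‖ ^ 2 := by
  rw [iterate_partialDeriv_realTrigPoly, integral_norm_sq_realTrigPoly hS (hc.iterate_deriv i j)]
  refine Finset.sum_congr rfl fun k _ => ?_
  rw [norm_derivSymbol_pow_smul, mul_pow]

/-! ## Sup bounds (`H² ⊂ L^∞` on the coefficient side) -/

/-- **Sup bound for pure derivatives**: `‖∂ᵢʲ (realTrigPoly S c)(x)‖ ≤ ∑_{k∈S} (2π|kᵢ|)ʲ ‖c k‖`.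
[folklore] -/
theorem norm_iterate_partialDeriv_realTrigPoly_le_sum (S : Finset (d → ℤ))
    (c : (d → ℤ) → EuclideanSpace ℂ d) (i : d) (j : ℕ) (x : UnitAddTorus d) :
    ‖(partialDeriv i)^[j] (realTrigPoly S c) x‖ ≤ ∑ k ∈ S, (2 * Real.pi * |(k i : ℝ)|) ^ j * ‖c k‖ := by
  rw [iterate_partialDeriv_realTrigPoly]
  refine (norm_realTrigPoly_apply_le _ _ x).trans (le_of_eq (Finset.sum_congr rfl fun k _ => ?_))
  exact norm_derivSymbol_pow_smul k i j (c k)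

omit [DecidableEq d] in
/-- **Cauchy–Schwarz step of the embedding**: if `∑_{k∈S} ((1+|k|²)²)⁻¹ ≤ B`, then
`(∑_{k∈S} (2π|kᵢ|)ʲ ‖c k‖)² ≤ B (2π)^{2j} ∑_{k∈S} (1+|k|²)^{j+2} ‖c k‖²`. [folklore] -/
theorem sq_sum_derivSymbol_mul_norm_le {S : Finset (d → ℤ)} (c : (d → ℤ) → EuclideanSpace ℂ d)
    (i : d) (j : ℕ) {B : ℝ} (hB : ∑ k ∈ S, ((1 + freqNormSq k) ^ 2)⁻¹ ≤ B) :
    (∑ k ∈ S, (2 * Real.pi * |(k i : ℝ)|) ^ j * ‖c k‖) ^ 2 ≤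
      B * ((2 * Real.pi) ^ (2 * j) * ∑ k ∈ S, (1 + freqNormSq k) ^ (j + 2) * ‖c k‖ ^ 2) := by
  have hw : ∀ k : d → ℤ, 0 < 1 + freqNormSq k := fun k => by linarith [freqNormSq_nonneg k]
  -- split each term as `(1+|k|²)⁻¹ · ((1+|k|²) (2π|kᵢ|)ʲ ‖c k‖)`
  have hsplit : ∀ k ∈ S, (2 * Real.pi * |(k i : ℝ)|) ^ j * ‖c k‖ =
      (1 + freqNormSq k)⁻¹ * ((1 + freqNormSq k) * ((2 * Real.pi * |(k i : ℝ)|) ^ j * ‖c k‖)) := by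
    intro k _
    rw [← mul_assoc, inv_mul_cancel₀ (hw k).ne', one_mul]
  rw [Finset.sum_congr rfl hsplit]
  refine (Finset.sum_mul_sq_le_sq_mul_sq S (fun k => (1 + freqNormSq k)⁻¹)
    (fun k => (1 + freqNormSq k) * ((2 * Real.pi * |(k i : ℝ)|) ^ j * ‖c k‖))).trans ?_
  have h1 : ∑ k ∈ S, ((1 + freqNormSq k)⁻¹) ^ 2 ≤ B := by
    refine le_trans (le_of_eq (Finset.sum_congr rfl fun k _ => ?_)) hB
    rw [inv_pow]
  have h2 : ∑ k ∈ S, ((1 + freqNormSq k) * ((2 * Real.pi * |(k i : ℝ)|) ^ j * ‖c k‖)) ^ 2 ≤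
      (2 * Real.pi) ^ (2 * j) * ∑ k ∈ S, (1 + freqNormSq k) ^ (j + 2) * ‖c k‖ ^ 2 := by
    rw [Finset.mul_sum]
    refine Finset.sum_le_sum fun k _ => ?_
    have hd := derivSymbol_sq_pow_le k i j
    have hw0 : 0 ≤ (1 + freqNormSq k) ^ 2 := sq_nonneg _
    calc ((1 + freqNormSq k) * ((2 * Real.pi * |(k i : ℝ)|) ^ j * ‖c k‖)) ^ 2
        = (1 + freqNormSq k) ^ 2 * ((2 * Real.pi * |(k i : ℝ)|) ^ j) ^ 2 * ‖c k‖ ^ 2 := by ring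
      _ ≤ (1 + freqNormSq k) ^ 2 * ((2 * Real.pi) ^ (2 * j) * (1 + freqNormSq k) ^ j) * ‖c k‖ ^ 2 := by
          gcongr
      _ = (2 * Real.pi) ^ (2 * j) * ((1 + freqNormSq k) ^ (j + 2) * ‖c k‖ ^ 2) := by ring
  have h20 : 0 ≤ ∑ k ∈ S, ((1 + freqNormSq k) * ((2 * Real.pi * |(k i : ℝ)|) ^ j * ‖c k‖)) ^ 2 :=
    Finset.sum_nonneg fun k _ => sq_nonneg _
  calc (∑ k ∈ S, ((1 + freqNormSq k)⁻¹) ^ 2) *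
        ∑ k ∈ S, ((1 + freqNormSq k) * ((2 * Real.pi * |(k i : ℝ)|) ^ j * ‖c k‖)) ^ 2
      ≤ B * ∑ k ∈ S, ((1 + freqNormSq k) * ((2 * Real.pi * |(k i : ℝ)|) ^ j * ‖c k‖)) ^ 2 :=
        mul_le_mul_of_nonneg_right h1 h20
    _ ≤ B * ((2 * Real.pi) ^ (2 * j) * ∑ k ∈ S, (1 + freqNormSq k) ^ (j + 2) * ‖c k‖ ^ 2) :=
        mul_le_mul_of_nonneg_left h2 ((Finset.sum_nonneg fun k _ => sq_nonneg _).trans h1)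

/-- **Sup bound for pure derivatives through the `H^{j+2}` weight** (the embedding
`H² ⊂ L^∞` on the torus, coefficient side): if `∑_{k∈S} ((1+|k|²)²)⁻¹ ≤ B` then
`‖∂ᵢʲ (realTrigPoly S c)(x)‖² ≤ B (2π)^{2j} ∑_{k∈S} (1+|k|²)^{j+2} ‖c k‖²`.
[cite: RobinsonRodrigoSadowski2016, §1.5] -/
theorem sq_norm_iterate_partialDeriv_realTrigPoly_le {S : Finset (d → ℤ)}
    (c : (d → ℤ) → EuclideanSpace ℂ d) (i : d) (j : ℕ) {B : ℝ}
    (hB : ∑ k ∈ S, ((1 + freqNormSq k) ^ 2)⁻¹ ≤ B) (x : UnitAddTorus d) :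
    ‖(partialDeriv i)^[j] (realTrigPoly S c) x‖ ^ 2 ≤
      B * ((2 * Real.pi) ^ (2 * j) * ∑ k ∈ S, (1 + freqNormSq k) ^ (j + 2) * ‖c k‖ ^ 2) := by
  have h := norm_iterate_partialDeriv_realTrigPoly_le_sum S c i j x
  have h0 : 0 ≤ ∑ k ∈ S, (2 * Real.pi * |(k i : ℝ)|) ^ j * ‖c k‖ :=
    Finset.sum_nonneg fun k _ => by positivity
  calc ‖(partialDeriv i)^[j] (realTrigPoly S c) x‖ ^ 2
      ≤ (∑ k ∈ S, (2 * Real.pi * |(k i : ℝ)|) ^ j * ‖c k‖) ^ 2 := pow_le_pow_left₀ (norm_nonneg _) h 2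
    _ ≤ B * ((2 * Real.pi) ^ (2 * j) * ∑ k ∈ S, (1 + freqNormSq k) ^ (j + 2) * ‖c k‖ ^ 2) :=
        sq_sum_derivSymbol_mul_norm_le c i j hB

/-! ## Monotonicity of the weights -/

omit [DecidableEq d] in
/-- The Sobolev weights increase with the order: for `j ≤ m`,
`∑_{k∈S} (1+|k|²)ʲ ‖c k‖² ≤ ∑_{k∈S} (1+|k|²)ᵐ ‖c k‖²`. [folklore] -/
theorem sum_weight_pow_mul_norm_sq_mono (S : Finset (d → ℤ)) (c : (d → ℤ) → EuclideanSpace ℂ d)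
    {j m : ℕ} (hjm : j ≤ m) :
    ∑ k ∈ S, (1 + freqNormSq k) ^ j * ‖c k‖ ^ 2 ≤ ∑ k ∈ S, (1 + freqNormSq k) ^ m * ‖c k‖ ^ 2 := by
  refine Finset.sum_le_sum fun k _ => mul_le_mul_of_nonneg_right ?_ (sq_nonneg _)
  exact pow_le_pow_right₀ (by linarith [freqNormSq_nonneg k]) hjm

end EulerGalerkin

end Literature.Analysis.FluidPDE
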